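import Mathlib

/-!
# Gram entries of the flat-size lemma: `n² ≤ (Q + 1)·n − Q`
# (crux `LevelGradedCohnUmans.GradedDesignFamily`, stmt-MatrixMultiplication-7610; negative side,
# line `quadratic-extension-level-one-cell`, stub `gl2Flat_gram_sq_le`)

For two distinct `2 × 2` matrices `x ≠ y` over a finite field `K` with `Q := |K|` elements, the
Gram entry `n := #{u ∈ K² : x·u = y·u}` of the flat-size lemma satisfies

* `gl2Flat_gram_sq_le` — `n ^ 2 ≤ (Q + 1) * n - Q` (as real numbers), i.e. `(n - 1)(n - Q) ≤ 0`.

Proof: `{u : x·u = y·u} = ker D` for the linear map `D := (x - y).mulVecLin : K² → K²`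
(`Matrix.sub_mulVec`, `sub_eq_zero`), so `n = Q ^ finrank (ker D)` (`Module.card_eq_pow_finrank`).
Since `x ≠ y`, `D ≠ 0` (`Matrix.toLin'` is injective), so `range D ≠ ⊥` has `finrank ≥ 1` and
rank–nullity (`LinearMap.finrank_range_add_finrank_ker`, `finrank K² = 2`) gives
`finrank (ker D) ≤ 1`.  Hence `n ∈ {1, Q}`, and both values satisfy `n² = (Q + 1)n − Q`.

This is ingredient (ii) of the flat-size lemma of the line's negative programme (the off-diagonal
Gram entries `n(x, y)` of the indicator frame `g ↦ [g·u = w]` on `GL₂(K)`).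

Sorry-free; axioms `propext`, `Classical.choice`, `Quot.sound`.
-/

set_option linter.dupNamespace false

open scoped BigOperators

namespace Summit.MatrixMultiplication.MatrixMultiplication.Theorems.GradedDesignFamily.Negative

/-- **Gram square bound.**  For distinct `2 × 2` matrices `x ≠ y` over a finite field `K`
(`Q := |K|`), the number `n := #{u : Fin 2 → K | x·u = y·u}` satisfies
`n ^ 2 ≤ (Q + 1) * n - Q`; indeed `n = |ker (x - y)| ∈ {1, Q}`. [folklore] -/
theorem gl2Flat_gram_sq_le : ∀ {K : Type} [Field K] [Fintype K] [DecidableEq K]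
    (x y : Matrix (Fin 2) (Fin 2) K), x ≠ y →
    ((Finset.univ.filter fun u : Fin 2 → K => x.mulVec u = y.mulVec u).card : ℝ) ^ 2 ≤
      ((Fintype.card K : ℝ) + 1) *
          (Finset.univ.filter fun u : Fin 2 → K => x.mulVec u = y.mulVec u).card -
        (Fintype.card K : ℝ) := by
  intro K _ _ _ x y hxy
  classical
  set S := Finset.univ.filter fun u : Fin 2 → K => x.mulVec u = y.mulVec u with hS
  -- `S` is the kernel of the nonzero linear map `D := (x - y)·(-)`
  set D : (Fin 2 → K) →ₗ[K] (Fin 2 → K) := (x - y).mulVecLin with hD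
  -- adapted from Literature/InformationTheory/Entropy/LinearMapEntropy.lean
  -- (`card_filter_apply_eq_zero`)
  have hcard : S.card = Fintype.card K ^ Module.finrank K (LinearMap.ker D) := by
    rw [← Module.card_eq_pow_finrank (K := K) (V := LinearMap.ker D)]
    exact (Fintype.card_of_subtype S fun w => by
      simp [hS, hD, LinearMap.mem_ker, sub_eq_zero]).symm
  have hD0 : D ≠ 0 := by
    intro h
    apply hxy
    rw [← sub_eq_zero]
    apply Matrix.toLin'.injective
    rw [Matrix.toLin'_apply', map_zero]
    exact h
  -- rank–nullity: `finrank (ker D) ≤ 1`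
  have hker : Module.finrank K (LinearMap.ker D) ≤ 1 := by
    have h1 := LinearMap.finrank_range_add_finrank_ker D
    rw [Module.finrank_fin_fun] at h1
    have hr : 1 ≤ Module.finrank K (LinearMap.range D) := by
      rw [Submodule.one_le_finrank_iff, Ne, LinearMap.range_eq_bot]
      exact hD0
    omega
  obtain ⟨d, hd⟩ : ∃ d, Module.finrank K (LinearMap.ker D) = d := ⟨_, rfl⟩
  rw [hd] at hker hcard
  rw [hcard]
  push_cast
  interval_cases d
  · norm_num
  · simp only [pow_one]
    exact le_of_eq (by ring)

end Summit.MatrixMultiplication.MatrixMultiplication.Theorems.GradedDesignFamily.Negative
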